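import Mathlib

/-!
# Rank-one lift of a zero mode (solo-informed, s14; claim C68)

Abstract linear-algebra kernel of the FIRST-ORDER DEGENERACY of the direct/exchange split in the
Mott limit (`paper/sharpest.md` §4.10(x), `work/s15/mott_summary.md` §2).  In the `t/U → 0`
effective model of one particle added to the unit-filling Mott state, the impurity sector
Hamiltonian at total momentum `k` has the form `h(k) - z = (h(0) - z) + ε(k) |a⟩⟨a|`
(the only `k`-dependence is the diagonal energy of the impurity plane wave `a = F₁`), and
`h(0) - z ≥ 0` has the explicit null vector `v = √2 a + Σ_r |r⟩` with `⟪a, v⟫ = √2 ≠ 0`.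
The lemmas below then give `D(k) = ⟪a, (h(k) - z)⁻¹ a⟫ = 1/ε(k)` exactly, for every lattice size:

* `SoloInformed.rankOneLift_solution` : if `M₀ v = 0` then `u₀ := (s ⟪a,v⟫)⁻¹ • v` solves
  `M₀ u₀ + (s ⟪a,u₀⟫) • a = a` and `⟪a, u₀⟫ = s⁻¹`;
* `SoloInformed.rankOneLift_injective_of_nonneg` : if `M₀` is a nonnegative form whose isotropic vectors are
  multiples of `v`, `⟪a,v⟫ ≠ 0` and `0 < s`, then `w ↦ M₀ w + (s ⟪a,w⟫) • a` is injective;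
* `SoloInformed.inner_solution_rankOneLift` : hence EVERY solution `u` of `M₀ u + (s ⟪a,u⟫) • a = a` has
  `⟪a, u⟫ = s⁻¹` — the resolvent expectation of `a` under the rank-one lift of a zero mode is `1/s`,
  independently of everything else in `M₀`.

Weak-inverse formulation (`M u = a` as a hypothesis) as in the other `SoloInformed*` kernels; no
operator inverses, no spectral theory.  Standard axioms only.
-/

namespace Summit.AtomisticToContinuum.BoseEinsteinCondensation.Theorems

open scoped InnerProductSpace

variable {E : Type*} [NormedAddCommGroup E] [InnerProductSpace ℝ E]

/-- The rank-one lift `w ↦ M₀ w + (s ⟪a, w⟫) • a` of a linear map `M₀`. -/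
def SoloInformed.rankOneLift (M₀ : E →ₗ[ℝ] E) (a : E) (s : ℝ) (w : E) : E :=
  M₀ w + (s * ⟪a, w⟫_ℝ) • a

/-- The rank-one lift is additive: `lift (x - y) = lift x - lift y`. -/
theorem SoloInformed.rankOneLift_sub (M₀ : E →ₗ[ℝ] E) (a : E) (s : ℝ) (x y : E) :
    SoloInformed.rankOneLift M₀ a s (x - y) = SoloInformed.rankOneLift M₀ a s x - SoloInformed.rankOneLift M₀ a s y := by
  unfold SoloInformed.rankOneLift
  rw [map_sub, inner_sub_right, mul_sub, sub_smul]
  abel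

/-- The rank-one lift is homogeneous: `lift (c • x) = c • lift x`. -/
theorem SoloInformed.rankOneLift_smul (M₀ : E →ₗ[ℝ] E) (a : E) (s c : ℝ) (x : E) :
    SoloInformed.rankOneLift M₀ a s (c • x) = c • SoloInformed.rankOneLift M₀ a s x := by
  unfold SoloInformed.rankOneLift
  rw [map_smul, inner_smul_right, smul_add, smul_smul]
  congr 1
  ring_nf

/-- The explicit solution: a rescaled zero mode of `M₀` solves the lifted equation with
right-hand side `a`, and its overlap with `a` is `1/s`. -/
theorem SoloInformed.rankOneLift_solution (M₀ : E →ₗ[ℝ] E) (a v : E) (s : ℝ) (hs : s ≠ 0)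
    (hv : M₀ v = 0) (hav : ⟪a, v⟫_ℝ ≠ 0) :
    SoloInformed.rankOneLift M₀ a s ((s * ⟪a, v⟫_ℝ)⁻¹ • v) = a ∧
      ⟪a, (s * ⟪a, v⟫_ℝ)⁻¹ • v⟫_ℝ = s⁻¹ := by
  refine ⟨?_, ?_⟩
  · unfold SoloInformed.rankOneLift
    rw [map_smul, hv, smul_zero, zero_add, inner_smul_right]
    have h1 : s * ((s * ⟪a, v⟫_ℝ)⁻¹ * ⟪a, v⟫_ℝ) = 1 := by
      field_simp
    rw [h1, one_smul]
  · rw [inner_smul_right]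
    field_simp

/-- Injectivity of the rank-one lift from positivity: if `M₀` is a nonnegative form whose
isotropic vectors are multiples of the zero mode `v`, `⟪a, v⟫ ≠ 0` and `0 < s`, then the lifted
map has trivial kernel. -/
theorem SoloInformed.rankOneLift_injective_of_nonneg (M₀ : E →ₗ[ℝ] E) (a v : E) (s : ℝ) (hs : 0 < s)
    (hpos : ∀ w : E, 0 ≤ ⟪w, M₀ w⟫_ℝ)
    (hker : ∀ w : E, ⟪w, M₀ w⟫_ℝ = 0 → ∃ c : ℝ, w = c • v)
    (hav : ⟪a, v⟫_ℝ ≠ 0) :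
    ∀ w : E, SoloInformed.rankOneLift M₀ a s w = 0 → w = 0 := by
  intro w hw
  have hform : ⟪w, M₀ w⟫_ℝ + s * ⟪a, w⟫_ℝ ^ 2 = 0 := by
    have h0 : ⟪w, SoloInformed.rankOneLift M₀ a s w⟫_ℝ = 0 := by rw [hw, inner_zero_right]
    unfold SoloInformed.rankOneLift at h0
    rw [inner_add_right, inner_smul_right, real_inner_comm a w] at h0
    nlinarith [h0]
  have h1 : 0 ≤ s * ⟪a, w⟫_ℝ ^ 2 := by positivity
  have h2 : ⟪w, M₀ w⟫_ℝ = 0 := by linarith [hpos w]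
  have h3 : s * ⟪a, w⟫_ℝ ^ 2 = 0 := by linarith [hpos w]
  have haw : ⟪a, w⟫_ℝ = 0 := by
    have : ⟪a, w⟫_ℝ ^ 2 = 0 := by
      rcases mul_eq_zero.mp h3 with h | h
      · exact absurd h (ne_of_gt hs)
      · exact h
    exact pow_eq_zero_iff (n := 2) (by norm_num) |>.mp this
  obtain ⟨c, hc⟩ := hker w h2
  have hc0 : c * ⟪a, v⟫_ℝ = 0 := by
    rw [hc, inner_smul_right] at haw
    exact haw
  have : c = 0 := by
    rcases mul_eq_zero.mp hc0 with h | h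
    · exact h
    · exact absurd h hav
  rw [hc, this, zero_smul]

/-- Every solution of the lifted equation with right-hand side `a` has overlap `1/s` with `a`
(given injectivity of the lift): the impurity susceptibility equals `1/ε(k)` at order `t`. -/
theorem SoloInformed.inner_solution_rankOneLift (M₀ : E →ₗ[ℝ] E) (a v u : E) (s : ℝ) (hs : s ≠ 0)
    (hv : M₀ v = 0) (hav : ⟪a, v⟫_ℝ ≠ 0)
    (hinj : ∀ w : E, SoloInformed.rankOneLift M₀ a s w = 0 → w = 0)
    (hu : SoloInformed.rankOneLift M₀ a s u = a) : ⟪a, u⟫_ℝ = s⁻¹ := by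
  obtain ⟨h1, h2⟩ := SoloInformed.rankOneLift_solution M₀ a v s hs hv hav
  have hdiff : SoloInformed.rankOneLift M₀ a s (u - (s * ⟪a, v⟫_ℝ)⁻¹ • v) = 0 := by
    rw [SoloInformed.rankOneLift_sub, hu, h1, sub_self]
  have heq : u = (s * ⟪a, v⟫_ℝ)⁻¹ • v := by
    have := hinj _ hdiff
    exact sub_eq_zero.mp this
  rw [heq]
  exact h2

/-- Packaged form used in the text: nonnegative `M₀` with one-dimensional isotropic cone
spanned by `v`, `⟪a,v⟫ ≠ 0`, `0 < s`; any weak solution of `(M₀ + s|a⟩⟨a|) u = a` has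
`⟪a, u⟫ = 1/s`. -/
theorem SoloInformed.inner_solution_rankOneLift_of_nonneg (M₀ : E →ₗ[ℝ] E) (a v u : E) (s : ℝ)
    (hs : 0 < s) (hv : M₀ v = 0)
    (hpos : ∀ w : E, 0 ≤ ⟪w, M₀ w⟫_ℝ)
    (hker : ∀ w : E, ⟪w, M₀ w⟫_ℝ = 0 → ∃ c : ℝ, w = c • v)
    (hav : ⟪a, v⟫_ℝ ≠ 0)
    (hu : M₀ u + (s * ⟪a, u⟫_ℝ) • a = a) : ⟪a, u⟫_ℝ = s⁻¹ :=
  SoloInformed.inner_solution_rankOneLift M₀ a v u s (ne_of_gt hs) hv hav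
    (SoloInformed.rankOneLift_injective_of_nonneg M₀ a v s hs hpos hker hav) hu

end Summit.AtomisticToContinuum.BoseEinsteinCondensation.Theorems
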